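import Literature.NumberTheory.Sieve.GreenTao2008LinearFormsProofs
import Literature.NumberTheory.Sieve.LinearEquationsInPrimesSieveWeights
import Literature.NumberTheory.Sieve.GreenTao2008RelativeSzemeredi
import Mathlib.Analysis.Calculus.BumpFunction.InnerProduct
import Mathlib.Analysis.SpecialFunctions.Integrals.Basic
import HarnessLib

/-!
# The smooth Goldston–Yıldırım majorant (Tao; Conlon–Fox–Zhao §8) in Green–Tao's framework

Trunk T-SIEVE. Conlon–Fox–Zhao (*The Green–Tao theorem: an exposition*, EMS Surv. 1 (2014),
§8, following Tao's note) replace the truncated divisor sum `Λ_R` of Green–Tao's Definition 9.2 by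
the smoothly truncated `Λ_{χ,R}(n) = log R ∑_{d ∣ n} μ(d) χ(log d / log R)` (Def. 8.2), for
which the linear forms estimate (Prop. 8.3) has an elementary proof (§9 of the source: Fourier
expansion of `e^x χ(x)`, Euler products, and only `ζ(s) = 1/(s-1) + O(1)` near `s = 1`) — unlike
Green–Tao's Proposition 9.5, whose printed proof (§10 and the Appendix) is a contour integration
using the classical zero-free region. This file puts the smooth majorant into the framework
already in the tree:

* `smoothDivisorSum χ R n = Λ_{χ,R}(n)` (Def. 8.2) — an abbreviation for the tree's
  `Literature.truncDivisorSum χ R 1 n = log R · Literature.moebiusDivisorSum χ R n` (Green–Tao 2010, App. D,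
  `Literature/NumberTheory/Sieve/LinearEquationsInPrimesSieveWeights.lean`: the same object, divisors
  `d ≤ R` — all of them when `supp χ ⊆ [-1,1]`), `cChi χ = c_χ = ∫_0^∞ χ'(x)² dx`, the cutoff class
  `IsSmoothCutoff` (smooth, `[0,1]`-valued, supported in `[-1,1]`), and the measure
  `smoothMeasure χ k w` (Green–Tao's Definition 9.3 with `Λ_{χ,R}` and the normaliser `c_χ log R`;
  CFZ (8.2) use the window `[N/2, N)` and `R = N^{k⁻¹2^{-k-3}}`, here Green–Tao's window
  `[ε_k N, 2ε_k N]` and `R = N^{k⁻¹2^{-k-4}}` are kept so that the tree's assembly applies unchanged);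
* the named fact `SmoothLinearFormsEstimate` — CFZ Proposition 8.3, vendored as its documented
  corollary PER FIXED COEFFICIENT BOUND `C`: for fixed `(m, t, C)` there are finitely many integer
  systems `L` with `|L_{ij}| ≤ C`, so "fixed `ψ_1, …, ψ_m`" (as printed) and "all `L` with
  `|L_{ij}| ≤ C`" are equivalent by `Filter.eventually_all`; the affine shifts `b_i` are those of
  Green–Tao 2010, App. D, Thm. D.3 (the printed affine version of the estimate), and the printed §9
  proof is uniform in `b` (the shifts enter only through the local densities). The stronger reading
  "uniform over `|L_{ij}| ≤ √(w(N))/2`" (the shape of Green–Tao 2008 Prop. 9.5) is NOT what CFZ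
  print and is not vendored; the deduction below only ever uses the bound `C = k · k!`;
* proved: `smoothDivisorSum_prime` (`Λ_{χ,R}(p) = χ(0) log R` for a prime `p > R`),
  `smoothMeasure_majorises` (CFZ proof of Prop. 8.1 from Prop. 8.4: `ν ≥ (k⁻¹2^{-k-5}/c_χ) Λ̃`
  on the window), `smoothMeasure_linearFormsCondition` (Green–Tao's `(k2^{k-1}, 3k-4, k)`-linear
  forms condition for `smoothMeasure`, by the tree's generic `linearFormsCondition_of_boxAsymptotic`
  = CFZ's proof of Prop. 8.4), `cChi_pos_of_bump` (`c_χ > 0` for a genuine bump), and the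
  resulting reduction `Literature.Parity.exists_prime_arithmetic_progression_of_smooth
  (hcfz : CFZ.RelativeSzemeredi) (h83 : SmoothLinearFormsEstimate)`: **Green–Tao's Theorem 1.1
  from the Conlon–Fox–Zhao relative Szemerédi theorem and the smooth linear forms estimate**, both
  of which have elementary printed proofs (given Szemerédi's theorem).

## References

* D. Conlon, J. Fox, Y. Zhao, *The Green–Tao theorem: an exposition*, EMS Surv. Math. Sci. 1
  (2014), 249–282: Def. 8.2, Prop. 8.3, Prop. 8.4 and the proof of Prop. 8.1, §9.
  [cite: ConlonFoxZhao2014]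
* B. Green, T. Tao, Ann. of Math. 167 (2008): Def. 9.3, Lemma 9.4 (the shape of the measure and
  of the majorisation). [cite: GreenTaoAnnals2008]
* B. Green, T. Tao, *Linear equations in primes*, Ann. of Math. 171 (2010), App. D (`Λ_{χ,R,a}`,
  Thm. D.3: the affine version of the estimate). [cite: GreenTao2010]
-/

noncomputable section

open Filter Finset Topology MeasureTheory
open scoped BigOperators

namespace Literature.NumberTheory.Sieve.GreenTao2008

/-! ### Definition 8.2 and the cutoff class -/

/-- **Conlon–Fox–Zhao, Definition 8.2 (Tao's smoothly truncated divisor sum).**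
`Λ_{χ,R}(n) = log R ∑_{d ∣ n} μ(d) χ(log d / log R)`, the sum over the positive divisors `d ≤ R`
(for `χ` supported in `[-1,1]` and `R ≥ 1` these are all the divisors that contribute), `n ∈ ℤ`.
This is the tree's `Literature.truncDivisorSum χ R 1` (Green–Tao 2010, App. D, exponent `a = 1`); kept
as an abbreviation so that the CFZ-facing statements read as printed.
[cite: ConlonFoxZhao2014, Definition 8.2] -/
abbrev smoothDivisorSum (χ : ℝ → ℝ) (R : ℝ) (n : ℤ) : ℝ := Literature.NumberTheory.Sieve.truncDivisorSum χ R 1 n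

/-- **The normalising factor `c_χ = ∫_0^∞ |χ'(x)|² dx`** of Proposition 8.3.
[cite: ConlonFoxZhao2014, Proposition 8.3] -/
def cChi (χ : ℝ → ℝ) : ℝ := ∫ x in Set.Ioi (0 : ℝ), (deriv χ x) ^ 2

/-- The cutoffs of §8: "any smooth function `χ : ℝ → [0,1]` supported on `[-1,1]`".
[cite: ConlonFoxZhao2014, Proposition 8.3] -/
structure IsSmoothCutoff (χ : ℝ → ℝ) : Prop where
  smooth : ContDiff ℝ (⊤ : ℕ∞) χ
  nonneg : ∀ x, 0 ≤ χ x
  le_one : ∀ x, χ x ≤ 1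
  eq_zero : ∀ x, 1 ≤ |x| → χ x = 0

/-- **Conlon–Fox–Zhao, (8.2) in Green–Tao's normalisation: the smooth majorant.** With
`R = N^{k⁻¹2^{-k-4}}`, `W = ∏_{p ≤ w(N)} p`:
`ν(n) = (φ(W)/W) Λ_{χ,R}(Wn+1)² / (c_χ log R)` on `ε_k N ≤ n ≤ 2ε_k N`, `ν(n) = 1` otherwise.
[cite: ConlonFoxZhao2014, Proposition 8.4 eq. 8.2] -/
def smoothMeasure (χ : ℝ → ℝ) (k : ℕ) (w : ℕ → ℕ) (N : ℕ) (x : ZMod N) : ℝ :=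
  if eps k * N ≤ (x.val : ℝ) ∧ (x.val : ℝ) ≤ 2 * eps k * N then
    (Nat.totient (primorial (w N)) : ℝ) / primorial (w N) *
      smoothDivisorSum χ (gyLevel k N) (primorial (w N) * x.val + 1) ^ 2 /
        (cChi χ * Real.log (gyLevel k N))
  else 1

/-- **Conlon–Fox–Zhao, Proposition 8.3 (linear forms estimate), per fixed coefficient bound.**
Fix a smooth `χ : ℝ → [0,1]` supported on `[-1,1]` (with `c_χ > 0`, i.e. `χ` not identically `0`
— for `χ = 0` the printed statement is the triviality `0 = (1+o(1))·0`, while the normalised form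
below would divide by `0`), positive integers `m, t` and a bound `C`. As printed (arXiv p. 16):
"Let `ψ_1, …, ψ_m : ℤ^t → ℤ` be fixed linear maps, with no two being multiples of each other.
Assume that `R = o(N^{1/(10m)})` grows with `N` and `w` grows sufficiently slowly with `N`. Let
`W := ∏_{p ≤ w} p`. Write `θ_i := W ψ_i + 1`. Let `B` be a product `∏ I_i` where each `I_i` is a set
of at least `R^{10m}` consecutive integers. Then
`E_{x ∈ B}[Λ_{χ,R}(θ_1(x))² ⋯ Λ_{χ,R}(θ_m(x))²] = (1 + o(1)) (W c_χ log R/φ(W))^m`,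
where `o(1)` … may depend on `χ, m, t, ψ_1, …, ψ_m, R, w`."
Vendored form: `R = N^{k⁻¹2^{-k-4}}` (`gyLevel`, the level fixed by `k` as in the accepted
`GoldstonYildirimLinearForms`; the printed proof only uses box sides `≥ R^{10m}`), `w = w(N) → ∞`
with `w ≤ G` for some `G → ∞` ("sufficiently slowly"), `N` through the primes, and the statement
for ALL integer systems `ψ_i(x) = ∑_j L_{ij} x_j + b_i` with `|L_{ij}| ≤ C`, nonzero pairwise
non-proportional rows and arbitrary shifts `b_i ∈ ℤ`: for fixed `(m, t, C)` the homogeneous parts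
range over a finite set, so this is the printed "fixed `ψ_i`" statement combined by
`Filter.eventually_all`; the shifts are those of the affine version, Green–Tao 2010, App. D,
Thm. D.3, and the §9 proof is uniform in them (they enter only through the local densities
`E_{ℤ_p^t}[1_{θ_j = 0 ∀ j ∈ X}] ∈ {1/p, ≤ 1/p²}`). Named fact; its discharge is in progress
(`SmoothMajorant*` files). [cite: ConlonFoxZhao2014, Proposition 8.3]
[cite: GreenTao2010, Appendix D, Theorem D.3] -/
def SmoothLinearFormsEstimate : Prop :=
  ∀ χ : ℝ → ℝ, IsSmoothCutoff χ → 0 < cChi χ →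
  ∀ k m t C : ℕ, 3 ≤ k → 1 ≤ m → 1 ≤ t → ∃ G : ℕ → ℕ, Tendsto G atTop atTop ∧
    ∀ w : ℕ → ℕ, Tendsto w atTop atTop → (∀ N, w N ≤ G N) →
      ∀ ε : ℝ, 0 < ε → ∀ᶠ N : ℕ in atTop, N.Prime →
        ∀ L : Fin m → Fin t → ℤ, (∀ i j, |L i j| ≤ C) → (∀ i, L i ≠ 0) →
          (∀ i i', i ≠ i' → ∀ c : ℚ, (fun j => (L i j : ℚ)) ≠ c • fun j => (L i' j : ℚ)) →
          ∀ b : Fin m → ℤ, ∀ a : Fin t → ℤ, ∀ ℓ : Fin t → ℕ,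
            (∀ j, gyLevel k N ^ (10 * m) ≤ ℓ j) →
            |(𝔼 x ∈ Fintype.piFinset fun j => Ico (a j) (a j + ℓ j),
                ∏ i, smoothDivisorSum χ (gyLevel k N)
                  (primorial (w N) * (∑ j, L i j * x j + b i) + 1) ^ 2) /
              (cChi χ * (primorial (w N) : ℝ) * Real.log (gyLevel k N) /
                Nat.totient (primorial (w N))) ^ m - 1| ≤ ε

/-! ### API and Lemma 9.4 for the smooth measure -/

/-- Unfolding `Λ_{χ,R}`. [cite: ConlonFoxZhao2014, Definition 8.2] -/
theorem smoothDivisorSum_def (χ : ℝ → ℝ) (R : ℝ) (n : ℤ) :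
    smoothDivisorSum χ R n = Real.log R * ∑ d ∈ (Icc 1 ⌊R⌋₊).filter (fun d : ℕ => (d : ℤ) ∣ n),
      (ArithmeticFunction.moebius d : ℝ) * χ (Real.log d / Real.log R) := by
  simp [smoothDivisorSum, Literature.NumberTheory.Sieve.truncDivisorSum, Literature.NumberTheory.Sieve.moebiusDivisorSum]

/-- `Λ_{χ,R} = log R · (∑_{e ∣ n} μ(e)χ(log e/log R))` in terms of the tree's `moebiusDivisorSum`.
[cite: ConlonFoxZhao2014, Definition 8.2] -/
theorem smoothDivisorSum_eq_mul_moebiusDivisorSum (χ : ℝ → ℝ) (R : ℝ) (n : ℤ) :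
    smoothDivisorSum χ R n = Real.log R * Literature.NumberTheory.Sieve.moebiusDivisorSum χ R n := by
  simp [smoothDivisorSum, Literature.NumberTheory.Sieve.truncDivisorSum]

/-- "Observe that if `n` has no prime divisors less than or equal to `R`, then
`Λ_{χ,R}(n) = χ(0) log R`": for a prime `p > R ≥ 1` only `d = 1` contributes.
[cite: ConlonFoxZhao2014, Section 8 (remark before Definition 8.2)] -/
theorem smoothDivisorSum_prime (χ : ℝ → ℝ) {R : ℝ} {p : ℕ} (hp : p.Prime) (hR : 1 ≤ R)
    (hpR : R < p) : smoothDivisorSum χ R p = χ 0 * Real.log R := by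
  rw [smoothDivisorSum_def]
  have hset : (Icc 1 ⌊R⌋₊).filter (fun d : ℕ => (d : ℤ) ∣ (p : ℤ)) = {1} := by
    ext d
    simp only [mem_filter, mem_Icc, mem_singleton]
    constructor
    · rintro ⟨⟨-, h2⟩, hd⟩
      have hd' : d ∣ p := Int.natCast_dvd_natCast.1 hd
      rcases (Nat.dvd_prime hp).1 hd' with h | h
      · exact h
      · exfalso
        rw [h] at h2
        have h3 : (p : ℝ) ≤ ⌊R⌋₊ := by exact_mod_cast h2
        linarith [Nat.floor_le (show (0 : ℝ) ≤ R by linarith)]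
    · rintro rfl
      exact ⟨⟨le_rfl, Nat.le_floor (by exact_mod_cast hR)⟩, by simp⟩
  rw [hset, sum_singleton]
  simp [mul_comm]

/-- `c_χ ≥ 0`. [cite: ConlonFoxZhao2014, Proposition 8.3] -/
theorem cChi_nonneg (χ : ℝ → ℝ) : 0 ≤ cChi χ :=
  setIntegral_nonneg measurableSet_Ioi fun _ _ => sq_nonneg _

/-- `ν ≥ 0` (the square, whatever the sign of `Λ_{χ,R}`; "`ν` … is always nonnegative due to the
square on `Λ_{χ,R}`", remark after Prop. 8.4; `c_χ ≥ 0` always).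
[cite: ConlonFoxZhao2014, Proposition 8.4] -/
theorem smoothMeasure_nonneg (χ : ℝ → ℝ) (k : ℕ) (w : ℕ → ℕ) (N : ℕ)
    (x : ZMod N) : 0 ≤ smoothMeasure χ k w N x := by
  have hc := cChi_nonneg χ
  unfold smoothMeasure
  split_ifs
  · exact div_nonneg (mul_nonneg (div_nonneg (Nat.cast_nonneg _) (Nat.cast_nonneg _))
      (sq_nonneg _)) (mul_nonneg hc (log_gyLevel_nonneg k N))
  · exact zero_le_one

/-- **The majorisation (CFZ, proof of Prop. 8.1 from Prop. 8.4; Green–Tao Lemma 9.4):** for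
`χ(0) = 1`, `c_χ > 0`, on the window and for `R ≥ 1`, `R < ε_k N`, `W ≤ N`:
`(k⁻¹2^{-k-5}/c_χ) Λ̃(n) ≤ ν(n)` (if `Wn+1 = p` is prime then `p > R`, `Λ_{χ,R}(p) = log R`, and
`ν(n) = (φ(W)/W) log R / c_χ ≥ (φ(W)/W) k⁻¹2^{-k-5} log(Wn+1)/c_χ` as `Wn + 1 ≤ N²`).
[cite: ConlonFoxZhao2014, Proposition 8.1 (proof)] -/
theorem smoothMeasure_majorises {χ : ℝ → ℝ} (hχ0 : χ 0 = 1) (hc : 0 < cChi χ) {k : ℕ} (hk : 1 ≤ k)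
    {w : ℕ → ℕ} {N n : ℕ} (hWN : primorial (w N) ≤ N) (hR1 : 1 ≤ gyLevel k N)
    (hRε : gyLevel k N < eps k * N) (h1 : eps k * N ≤ n) (h2 : (n : ℝ) ≤ 2 * eps k * N) :
    (k : ℝ)⁻¹ * 2⁻¹ ^ (k + 5) / cChi χ * modifiedVonMangoldt (primorial (w N)) n ≤
      smoothMeasure χ k w N (n : ZMod N) := by
  -- reduce to Green–Tao's Lemma 9.4 computation through the common value on primes
  set W : ℕ := primorial (w N) with hW_def
  have hW0 : 0 < W := primorial_pos _
  have hN0 : (0 : ℝ) < N := by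
    have h0 : 0 < eps k * N := lt_of_le_of_lt (gyLevel_nonneg k N) hRε
    by_contra h
    push Not at h
    have : eps k * N ≤ 0 := mul_nonpos_of_nonneg_of_nonpos (eps_pos k).le h
    linarith
  have hnN' : (n : ℝ) < N := by
    have := two_mul_eps_lt_one k
    calc (n : ℝ) ≤ 2 * eps k * N := h2
      _ < 1 * N := by gcongr
      _ = N := one_mul _
  have hnN : n < N := by exact_mod_cast hnN'
  haveI : NeZero N := ⟨by omega⟩
  have hv : (n : ZMod N).val = n := ZMod.val_cast_of_lt hnN
  by_cases hp : (W * n + 1).Prime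
  · have hpR : gyLevel k N < ((W * n + 1 : ℕ) : ℝ) := by
      have h3 : (n : ℝ) ≤ W * n := by
        have : (1 : ℝ) ≤ W := by exact_mod_cast hW0
        nlinarith [Nat.cast_nonneg (α := ℝ) n]
      push_cast
      linarith
    have hΛ : smoothDivisorSum χ (gyLevel k N) (W * n + 1 : ℕ) = Real.log (gyLevel k N) := by
      rw [smoothDivisorSum_prime χ hp hR1 hpR, hχ0, one_mul]
    unfold smoothMeasure
    rw [hv, if_pos ⟨h1, h2⟩, modifiedVonMangoldt_eq, if_pos hp]
    have hcast : ((W : ℤ) * (n : ℤ) + 1 : ℤ) = ((W * n + 1 : ℕ) : ℤ) := by push_cast; ring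
    rw [hcast, hΛ]
    have hlogR : 0 < Real.log (gyLevel k N) := by
      rw [log_gyLevel]
      have hN2 : (2 : ℝ) ≤ N := by
        have : 1 < N := by
          by_contra h
          push Not at h
          have hn0 : n = 0 := by omega
          subst hn0
          have : eps k * N ≤ 0 := by exact_mod_cast h1
          linarith [lt_of_le_of_lt (gyLevel_nonneg k N) hRε]
        exact_mod_cast this
      have : 0 < Real.log N := Real.log_pos (by linarith)
      have hk0 : (0 : ℝ) < k := by exact_mod_cast hk
      positivity
    have hlogp : Real.log ((W : ℝ) * n + 1) ≤ 2 * Real.log N := by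
      have hle : (W : ℝ) * n + 1 ≤ (N : ℝ) ^ 2 := by
        have hW' : (W : ℝ) ≤ N := by exact_mod_cast hWN
        have hn1 : (n : ℝ) + 1 ≤ N := by exact_mod_cast hnN
        nlinarith [Nat.cast_nonneg (α := ℝ) n, Nat.cast_nonneg (α := ℝ) W]
      calc Real.log ((W : ℝ) * n + 1) ≤ Real.log ((N : ℝ) ^ 2) :=
            Real.log_le_log (by positivity) hle
        _ = 2 * Real.log N := by rw [Real.log_pow]; norm_num
    have hkey : (k : ℝ)⁻¹ * 2⁻¹ ^ (k + 5) * Real.log ((W : ℝ) * n + 1) ≤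
        Real.log (gyLevel k N) := by
      rw [log_gyLevel]
      calc (k : ℝ)⁻¹ * 2⁻¹ ^ (k + 5) * Real.log ((W : ℝ) * n + 1)
          ≤ (k : ℝ)⁻¹ * 2⁻¹ ^ (k + 5) * (2 * Real.log N) := by gcongr
        _ = (k : ℝ)⁻¹ * 2⁻¹ ^ (k + 4) * Real.log N := by ring
    have hφ : 0 ≤ (Nat.totient W : ℝ) / W := by positivity
    calc (k : ℝ)⁻¹ * 2⁻¹ ^ (k + 5) / cChi χ * ((Nat.totient W : ℝ) / W * Real.log ((W : ℝ) * n + 1))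
        = (Nat.totient W : ℝ) / W * ((k : ℝ)⁻¹ * 2⁻¹ ^ (k + 5) * Real.log ((W : ℝ) * n + 1)) /
            cChi χ := by ring
      _ ≤ (Nat.totient W : ℝ) / W * Real.log (gyLevel k N) / cChi χ := by gcongr
      _ = (Nat.totient W : ℝ) / W * Real.log (gyLevel k N) ^ 2 /
            (cChi χ * Real.log (gyLevel k N)) := by
          field_simp
  · rw [modifiedVonMangoldt_eq, if_neg hp, mul_zero]
    exact smoothMeasure_nonneg χ k w N _

/-! ### The linear forms condition for the smooth measure (CFZ Prop. 8.4, Green–Tao's form) -/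

/-- **Conlon–Fox–Zhao, Proposition 8.4, in Green–Tao's form:** the smooth measure satisfies
Green–Tao's `(k 2^{k-1}, 3k-4, k)`-linear forms condition, for `w → ∞` below a growth bound,
granted Proposition 8.3; by the tree's generic `linearFormsCondition_of_boxAsymptotic` (the
localisation to `Q^t` boxes printed in both sources) with
`F_N(n) = (φ(W)/W) Λ_{χ,R}(Wn+1)²/(c_χ log R)` and `θ(N) = R^{10 k 2^{k-1}} = N^{5/16}`.
[cite: ConlonFoxZhao2014, Proposition 8.4] -/
theorem smoothMeasure_linearFormsCondition {χ : ℝ → ℝ} (hχ : IsSmoothCutoff χ) (hc : 0 < cChi χ)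
    (h83 : SmoothLinearFormsEstimate) {k : ℕ} (hk : 3 ≤ k) :
    ∃ G : ℕ → ℕ, Tendsto G atTop atTop ∧ ∀ w : ℕ → ℕ, Tendsto w atTop atTop → (∀ N, w N ≤ G N) →
      LinearFormsCondition (k * 2 ^ (k - 1)) (3 * k - 4) k (smoothMeasure χ k w) := by
  classical
  have hk1 : 1 ≤ k := by omega
  set m₀ : ℕ := k * 2 ^ (k - 1) with hm₀_def
  set t₀ : ℕ := 3 * k - 4 with ht₀_def
  have hm₀1 : 1 ≤ m₀ := Nat.mul_pos hk1 (Nat.two_pow_pos _)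
  have ht₀1 : 1 ≤ t₀ := by omega
  have h95' : ∀ mt : ℕ × ℕ, 1 ≤ mt.1 → 1 ≤ mt.2 → ∃ G : ℕ → ℕ, Tendsto G atTop atTop ∧
      ∀ w : ℕ → ℕ, Tendsto w atTop atTop → (∀ N, w N ≤ G N) →
        ∀ ε : ℝ, 0 < ε → ∀ᶠ N : ℕ in atTop, N.Prime →
          ∀ L : Fin mt.1 → Fin mt.2 → ℤ, (∀ i j, |L i j| ≤ (k * k.factorial : ℕ)) →
            (∀ i, L i ≠ 0) →
            (∀ i i', i ≠ i' → ∀ c : ℚ, (fun j => (L i j : ℚ)) ≠ c • fun j => (L i' j : ℚ)) →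
            ∀ b : Fin mt.1 → ℤ, ∀ a : Fin mt.2 → ℤ, ∀ ℓ : Fin mt.2 → ℕ,
              (∀ j, gyLevel k N ^ (10 * mt.1) ≤ ℓ j) →
              |(𝔼 x ∈ Fintype.piFinset fun j => Ico (a j) (a j + ℓ j),
                  ∏ i, smoothDivisorSum χ (gyLevel k N)
                    (primorial (w N) * (∑ j, L i j * x j + b i) + 1) ^ 2) /
                (cChi χ * (primorial (w N) : ℝ) * Real.log (gyLevel k N) /
                  Nat.totient (primorial (w N))) ^ mt.1 - 1| ≤ ε :=
    fun mt h1 h2 => h83 χ hχ hc k mt.1 mt.2 (k * k.factorial) hk h1 h2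
  choose! G hG H using h95'
  set I : Finset (ℕ × ℕ) := Icc 1 m₀ ×ˢ Icc 1 t₀ with hI_def
  have hIne : I.Nonempty := ⟨(1, 1), by simp [hI_def, hm₀1, ht₀1]⟩
  set Gmin : ℕ → ℕ := fun N => I.inf' hIne (fun mt => G mt N) with hGmin_def
  have hGmin : Tendsto Gmin atTop atTop := by
    rw [Filter.tendsto_atTop]
    intro b
    have hall : ∀ᶠ N in atTop, ∀ mt ∈ I, b ≤ G mt N :=
      (Filter.eventually_all_finset _).2 fun mt hmt => by
        have h1 : 1 ≤ mt.1 := (mem_Icc.1 (mem_product.1 hmt).1).1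
        have h2 : 1 ≤ mt.2 := (mem_Icc.1 (mem_product.1 hmt).2).1
        exact Filter.tendsto_atTop.1 (hG mt h1 h2) b
    filter_upwards [hall] with N hN
    exact Finset.le_inf' _ _ hN
  have hGminle : ∀ mt ∈ I, ∀ N, Gmin N ≤ G mt N := fun mt hmt N => Finset.inf'_le _ hmt
  have hfl : Tendsto (fun N : ℕ => ⌊Real.logb 4 (Real.log N)⌋₊) atTop atTop :=
    tendsto_nat_floor_atTop.comp ((Real.tendsto_logb_atTop (by norm_num)).comp
      (Real.tendsto_log_atTop.comp tendsto_natCast_atTop_atTop))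
  refine ⟨fun N => min (Gmin N) ⌊Real.logb 4 (Real.log N)⌋₊, tendsto_inf_atTop atTop hGmin hfl,
    fun w hw hwG => ?_⟩
  have hwG' : ∀ mt ∈ I, ∀ N, w N ≤ G mt N := fun mt hmt N =>
    (hwG N).trans ((min_le_left _ _).trans (hGminle mt hmt N))
  -- the function `F_N`
  set F : ℕ → ℤ → ℝ := fun N n =>
    (Nat.totient (primorial (w N)) : ℝ) / primorial (w N) *
      smoothDivisorSum χ (gyLevel k N) (primorial (w N) * n + 1) ^ 2 / (cChi χ * Real.log (gyLevel k N))
    with hF_def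
  have hF0 : ∀ N n, 0 ≤ F N n := fun N n =>
    div_nonneg (mul_nonneg (div_nonneg (Nat.cast_nonneg _) (Nat.cast_nonneg _)) (sq_nonneg _))
      (mul_nonneg hc.le (log_gyLevel_nonneg k N))
  have hν : ∀ N (x : ZMod N), smoothMeasure χ k w N x = if InWindow (eps k) N x.val then F N x.val else 1 := by
    intro N x
    by_cases hcw : eps k * N ≤ (x.val : ℝ) ∧ (x.val : ℝ) ≤ 2 * eps k * N
    · have hc' : InWindow (eps k) N x.val := by simpa [InWindow] using hcw
      rw [if_pos hc']
      unfold smoothMeasure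
      rw [if_pos hcw]
    · have hc' : ¬ InWindow (eps k) N x.val := by simpa [InWindow] using hcw
      rw [if_neg hc']
      unfold smoothMeasure
      rw [if_neg hcw]
  have hε2 : 2 * eps k < 1 := two_mul_eps_lt_one k
  -- shared eventualities
  have hlogR1 : ∀ᶠ N : ℕ in atTop, 1 ≤ Real.log (gyLevel k N) := by
    have hc : 0 < (k : ℝ)⁻¹ * 2⁻¹ ^ (k + 4) := by
      have : (0 : ℝ) < k := by exact_mod_cast hk1
      positivity
    have ht : Tendsto (fun N : ℕ => Real.log (gyLevel k N)) atTop atTop := by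
      simp_rw [log_gyLevel]
      exact Tendsto.const_mul_atTop hc (Real.tendsto_log_atTop.comp tendsto_natCast_atTop_atTop)
    exact ht.eventually_ge_atTop 1
  refine linearFormsCondition_of_boxAsymptotic F (eps_pos k) hε2 hν hF0
    (fun N => gyLevel k N ^ (10 * m₀)) (tendsto_gyLevel_pow_div_atTop hk1) ?_
  -- the linear forms asymptotic from CFZ Proposition 8.3
  intro m t hm1 hmm₀ ht1 htt₀ ε hε
  have hmt : (m, t) ∈ I := by
    simp only [hI_def, mem_product, mem_Icc]; exact ⟨⟨hm1, hmm₀⟩, ht1, htt₀⟩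
  have hev := H (m, t) hm1 ht1 w hw (hwG' (m, t) hmt) ε hε
  filter_upwards [hev, hlogR1, eventually_ge_atTop 1] with N hN hlogR hN1 hNp L hL hL0 hLp b a ℓ hℓ
  -- sizes at level N
  set W : ℕ := primorial (w N) with hW_def
  set R : ℝ := gyLevel k N with hR_def
  have hW0 : (0 : ℝ) < W := by exact_mod_cast primorial_pos (w N)
  have hφ0 : (0 : ℝ) < Nat.totient W := by exact_mod_cast Nat.totient_pos.2 (primorial_pos (w N))
  have hlogR0 : 0 < Real.log R := by simp only [hR_def]; linarith
  have hR1 : 1 ≤ R := one_le_gyLevel hN1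
  set M : ℝ := cChi χ * (W : ℝ) * Real.log R / Nat.totient W with hM_def
  have hM0 : 0 < M := by positivity
  have hFM : ∀ z : ℤ, F N z = M⁻¹ * smoothDivisorSum χ R ((W : ℤ) * z + 1) ^ 2 := by
    intro z
    simp only [hF_def, hM_def, hW_def, hR_def]
    field_simp
  -- Proposition 8.3 applies: coefficients and boxes
  have hL' : ∀ i j, |L i j| ≤ (k * k.factorial : ℕ) := fun i j => hL i j
  have hℓ' : ∀ j, gyLevel k N ^ (10 * m) ≤ ℓ j := by
    intro j
    refine le_trans ?_ (hℓ j)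
    exact pow_le_pow_right₀ hR1 (by nlinarith)
  have h83N := hN hNp L hL' hL0 hLp b a ℓ hℓ'
  -- normalise
  have hprod : ∀ x : Fin t → ℤ, ∏ i, F N (∑ j, L i j * x j + b i) =
      M⁻¹ ^ m * ∏ i, smoothDivisorSum χ R ((W : ℤ) * (∑ j, L i j * x j + b i) + 1) ^ 2 := by
    intro x
    rw [prod_congr rfl fun i _ => hFM _, prod_mul_distrib, prod_const, card_univ, Fintype.card_fin]
  simp_rw [hprod]
  rw [← mul_expect, inv_pow, ← div_eq_inv_mul]
  exact h83N



/-- The smooth measure is CFZ-pseudorandom (Green–Tao's linear forms condition implies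
Conlon–Fox–Zhao's, `cfzLinearFormsCondition_of_gt`). [cite: ConlonFoxZhao2014, Proposition 8.4] -/
theorem smoothMeasure_isCFZPseudorandom {χ : ℝ → ℝ} (hχ : IsSmoothCutoff χ) (hc : 0 < cChi χ)
    (h83 : SmoothLinearFormsEstimate) {k : ℕ} (hk : 3 ≤ k) :
    ∃ G : ℕ → ℕ, Tendsto G atTop atTop ∧ ∀ w : ℕ → ℕ, Tendsto w atTop atTop → (∀ N, w N ≤ G N) →
      IsCFZPseudorandom k (smoothMeasure χ k w) := by
  obtain ⟨G, hG, H⟩ := smoothMeasure_linearFormsCondition hχ hc h83 hk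
  exact ⟨G, hG, fun w hw hwG => ⟨smoothMeasure_nonneg χ k w,
    cfzLinearFormsCondition_of_gt hk (H w hw hwG)⟩⟩

/-- **Conlon–Fox–Zhao, Proposition 8.1 (a CFZ-pseudorandom majorant), from Proposition 8.3**, in
the form consumed by the transference assembly (`PseudorandomMajorantWith IsCFZPseudorandom`,
constant `c₀ = min(1, k⁻¹2^{-k-5}/c_χ)`), for any admissible cutoff with `χ(0) = 1`, `c_χ > 0`.
[cite: ConlonFoxZhao2014, Proposition 8.1] -/
theorem smoothMajorant {χ : ℝ → ℝ} (hχ : IsSmoothCutoff χ) (hχ0 : χ 0 = 1) (hc : 0 < cChi χ)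
    (h83 : SmoothLinearFormsEstimate) : PseudorandomMajorantWith IsCFZPseudorandom := by
  intro k hk
  have hk1 : 1 ≤ k := by omega
  obtain ⟨G₁, hG₁, H₁⟩ := smoothMeasure_isCFZPseudorandom hχ hc h83 hk
  have hfl : Tendsto (fun N : ℕ => ⌊Real.logb 4 (Real.log N)⌋₊) atTop atTop :=
    tendsto_nat_floor_atTop.comp ((Real.tendsto_logb_atTop (by norm_num)).comp
      (Real.tendsto_log_atTop.comp tendsto_natCast_atTop_atTop))
  set c₁ : ℝ := (k : ℝ)⁻¹ * 2⁻¹ ^ (k + 5) / cChi χ with hc₁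
  have hc₁0 : 0 < c₁ := by
    have := (majorisationConst_pos_le_one hk1).1
    positivity
  refine ⟨min 1 c₁, lt_min one_pos hc₁0, min_le_left _ _,
    fun N => min (G₁ N) ⌊Real.logb 4 (Real.log N)⌋₊, tendsto_inf_atTop atTop hG₁ hfl,
    fun w hw hwG => ?_⟩
  have hw₁ : ∀ N, w N ≤ G₁ N := fun N => (hwG N).trans (min_le_left _ _)
  have hw₃ : ∀ N, w N ≤ ⌊Real.logb 4 (Real.log N)⌋₊ := fun N => (hwG N).trans (min_le_right _ _)
  refine ⟨smoothMeasure χ k w, H₁ w hw hw₁, ?_⟩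
  have hRε : ∀ᶠ N : ℕ in atTop, gyLevel k N < eps k * N := by
    filter_upwards [(tendsto_gyLevel_div_atTop hk1).eventually (gt_mem_nhds (eps_pos k)),
      eventually_ge_atTop 1] with N hN hN1
    have hN0 : (0 : ℝ) < N := by exact_mod_cast hN1
    rwa [div_lt_iff₀ hN0] at hN
  filter_upwards [hRε, eventually_ge_atTop 3] with N hRεN hN3 _hNp n h1 h2
  have hN3' : (3 : ℝ) ≤ N := by exact_mod_cast hN3
  have hWN : primorial (w N) ≤ N := by
    have h := primorial_le_log hN3 (hw₃ N)
    have hlog : Real.log N ≤ N := (Real.log_le_sub_one_of_pos (by linarith)).trans (by linarith)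
    exact_mod_cast h.trans hlog
  calc min 1 c₁ * modifiedVonMangoldt (primorial (w N)) n
      ≤ c₁ * modifiedVonMangoldt (primorial (w N)) n :=
        mul_le_mul_of_nonneg_right (min_le_right _ _) (modifiedVonMangoldt_nonneg _ _)
    _ ≤ smoothMeasure χ k w N (n : ZMod N) :=
        smoothMeasure_majorises hχ0 hc hk1 hWN (one_le_gyLevel (by omega)) hRεN h1 h2

/-! ### A genuine bump and the positivity of `c_χ` -/

/-- The standard bump: `≡ 1` on `[-1/2, 1/2]`, supported in `(-1, 1)`, smooth, `[0,1]`-valued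
(Mathlib's `ContDiffBump`). [folklore] -/
def stdBump : ContDiffBump (0 : ℝ) := ⟨1 / 2, 1, by norm_num, by norm_num⟩

/-- The standard bump is an admissible cutoff with `χ(0) = 1`. [folklore] -/
theorem isSmoothCutoff_stdBump : IsSmoothCutoff stdBump ∧ (stdBump : ℝ → ℝ) 0 = 1 := by
  refine ⟨⟨stdBump.contDiff, fun x => stdBump.nonneg, fun x => stdBump.le_one, fun x hx => ?_⟩, ?_⟩
  · apply stdBump.zero_of_le_dist
    simpa [stdBump, Real.dist_eq] using hx
  · exact stdBump.one_of_mem_closedBall (by simp [stdBump])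

/-- `c_χ > 0` for the standard bump: by the mean value theorem `χ'(ξ) = (χ(2) - χ(0))/2 = -1/2`
for some `ξ ∈ (0, 2)`, and a continuous nonnegative integrable function positive at a point of
`(0, ∞)` has positive integral over `(0, ∞)`. [folklore] -/
theorem cChi_stdBump_pos : 0 < cChi stdBump := by
  set χ : ℝ → ℝ := (stdBump : ℝ → ℝ) with hχ
  have hdiff : Differentiable ℝ χ := (stdBump.contDiff (n := 1)).differentiable (by norm_num)
  have hcont' : Continuous (deriv χ) := (stdBump.contDiff (n := 1)).continuous_deriv le_rfl
  -- mean value theorem on `[0, 2]`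
  obtain ⟨ξ, hξ, hξ'⟩ := exists_deriv_eq_slope χ (by norm_num : (0 : ℝ) < 2)
    hdiff.continuous.continuousOn hdiff.differentiableOn
  have hχ2 : χ 2 = 0 := stdBump.zero_of_le_dist (by simp [stdBump])
  have hχ0 : χ 0 = 1 := stdBump.one_of_mem_closedBall (by simp [stdBump])
  rw [hχ2, hχ0] at hξ'
  have hξne : deriv χ ξ ≠ 0 := by rw [hξ']; norm_num
  -- the integrand `f = (χ')²`
  set f : ℝ → ℝ := fun x => deriv χ x ^ 2 with hf
  have hfcont : Continuous f := hcont'.pow 2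
  have hf0 : ∀ x, 0 ≤ f x := fun x => sq_nonneg _
  -- `χ' = 0` where `|x| > 1`, so `f` has compact support
  have hsupp : ∀ x, 1 < |x| → deriv χ x = 0 := by
    intro x hx
    have hev : χ =ᶠ[𝓝 x] fun _ => 0 := by
      have hopen : IsOpen {y : ℝ | 1 < |y|} := isOpen_lt continuous_const continuous_abs
      filter_upwards [hopen.mem_nhds hx] with y hy
      exact stdBump.zero_of_le_dist (by simpa [stdBump, Real.dist_eq] using le_of_lt hy)
    rw [hev.deriv_eq]
    exact deriv_const x 0
  have hcs : HasCompactSupport f := by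
    refine HasCompactSupport.intro (isCompact_Icc (a := (-1 : ℝ)) (b := 1)) fun x hx => ?_
    have : 1 < |x| := by
      rw [Set.mem_Icc, not_and_or, not_le, not_le] at hx
      rcases hx with h | h
      · rw [abs_of_neg (by linarith)]; linarith
      · rw [abs_of_pos (by linarith)]; linarith
    simp [hf, hsupp x this]
  have hint : Integrable f := hfcont.integrable_of_hasCompactSupport hcs
  -- positivity
  unfold cChi
  change 0 < ∫ x in Set.Ioi (0 : ℝ), f x
  rw [setIntegral_pos_iff_support_of_nonneg_ae (Eventually.of_forall hf0) hint.integrableOn]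
  -- a neighbourhood of `ξ` inside `support f ∩ (0, ∞)`
  have hfξ : 0 < f ξ := by simp only [hf]; positivity
  obtain ⟨δ, hδ, hball⟩ : ∃ δ > 0, ∀ y, dist y ξ < δ → 0 < f y := by
    have hev := hfcont.continuousAt.eventually (lt_mem_nhds hfξ)
    exact Metric.eventually_nhds_iff.1 hev
  have hsub : Set.Ioo ξ (ξ + δ) ⊆ Function.support f ∩ Set.Ioi 0 := by
    intro y hy
    refine ⟨(hball y ?_).ne', ?_⟩
    · rw [Real.dist_eq, abs_of_nonneg (by linarith [hy.1])]; linarith [hy.2]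
    · exact lt_trans hξ.1 hy.1
  calc (0 : ENNReal) < volume (Set.Ioo ξ (ξ + δ)) := by
        rw [Real.volume_Ioo]; simp [hδ]
    _ ≤ volume (Function.support f ∩ Set.Ioi 0) := measure_mono hsub

/-! ### Theorem 1.1 from two elementary named facts -/

/-- **Green–Tao's Theorem 1.1 from the Conlon–Fox–Zhao relative Szemerédi theorem (Thm. 4.3) and
the smooth linear forms estimate (Prop. 8.3)** — the two remaining named inputs on this route both
have elementary printed proofs (given Szemerédi's theorem): transference assembly
`exists_prime_arithmetic_progression_of_transference` with `P = IsCFZPseudorandom`, the majorant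
being the smooth measure for the standard bump.
[cite: ConlonFoxZhao2014, Theorem 1.1 (proof via Theorem 4.3 and Proposition 8.1)] -/
theorem _root_.Literature.NumberTheory.Sieve.exists_prime_arithmetic_progression_of_smooth
    (hcfz : Literature.Combinatorics.Additive.CFZ.RelativeSzemeredi) (h83 : SmoothLinearFormsEstimate) :
    Literature.NumberTheory.Sieve.exists_prime_arithmetic_progression :=
  Literature.NumberTheory.Sieve.exists_prime_arithmetic_progression_of_transference IsCFZPseudorandom
    (fun _ _ h => h.1) (relativeSzemerediWith_of_cfz hcfz)
    (smoothMajorant isSmoothCutoff_stdBump.1 isSmoothCutoff_stdBump.2 cChi_stdBump_pos h83)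
    ModifiedVonMangoldtSum_holds

end Literature.NumberTheory.Sieve.GreenTao2008
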